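import Mathlib
import HarnessLib
import Literature.MathematicalPhysics.StatisticalMechanics.TorusPolymers
import Literature.MathematicalPhysics.StatisticalMechanics.TorusBlocks

/-!
# Polymer expansions at scale `k`: blocks of a polymer, block products, the scale-`k` circle product

The polymer algebra of Adams–Buchholz–Kotecký–Müller [ABKM19] Ch. 6.2 on the torus
`Λ = (ℤ/M)^d` paved by centred blocks of side `s = L^k` (`TorusPolymer.blockOf`, `IsPolymer`):

* `polys s X` — the `k`-polymers `Y ⊆ X` (`𝓟_k(X)`); `blocks s X` — the `k`-blocks of `X`
  (`𝓑_k(X) = {B_x : x ∈ X}`); for a polymer these are pairwise disjoint with union `X`, and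
  `Y ↦ 𝓑_k(Y)` is a bijection `𝓟_k(X) ≃ 2^{𝓑_k(X)}` (`sum_polys_eq_sum_powerset_blocks`);
* `bprod s F X = ∏_{B ∈ 𝓑_k(X)} F(B)` — the multiplicative extension `F^X` of a one-block
  functional `F ∈ M(𝓑_k)` ([ABKM19] before (6.19)); multiplicative over disjoint polymers;
* `pcirc s F G X = Σ_{Y ∈ 𝓟_k(X)} F(Y) G(X ∖ Y)` — the circle product (6.19) at scale `k`;
  commutative, associative, unit `𝟙_∅` (`punit`), congruence in each argument on polymers;
* **the binomial expansion over blocks** (6.20): `(F₁ + F₂)^X = (F₁^∘ ∘ F₂^∘)(X)`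
  (`pcirc_bprod_bprod`), hence `F^X = (G^∘ ∘ (F−G)^∘)(X)` (`bprod_eq_pcirc_sub`) — the identities
  `I = Ĩ ∘ (I − Ĩ)`, `I − Ĩ = (1 − Ĩ) ∘ (I − 1)` that start the reblocking (6.31);
* two scales: for `L, s` odd every `(Ls)`-block is a union of `s`-blocks (`resIndex_mul`,
  `blockOf_subset_blockOf_mul`), so `(k+1)`-polymers are `k`-polymers (`IsPolymer.of_mul`) and a
  `k`-block product over a `(k+1)`-polymer is the `(k+1)`-block product of the `k`-block products
  (`bprod_eq_bprod_mul`) — `(e^{−H'})^{U} = ∏_{B'}∏_{B ∈ 𝓑_k(B')} e^{−H̃(B)}` in Definition 6.5;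
* the last scale: on an odd torus the block of side `M` is the whole torus (`blockOf_eq_univ`),
  the only `M`-polymers are `∅, Λ`, and `(F ∘ G)(Λ) = F(∅)G(Λ) + F(Λ)G(∅)` (`pcirc_univ_last`) —
  `(e^{−H_N} ∘ K_N)(Λ) = e^{−H_N(Λ)} + K_N(Λ)` in [ABKM19] (4.?)/Ch. 12.

Values are taken in an arbitrary commutative ring `R` (in the application `R = 𝕜` at a fixed field
configuration, or the ring of functionals of the field).  Everything is proved; no named fact.
The scale-free circle product over ALL subsets (blocks = sites) is `PolymerAlgebra.circ`
(`PolymerCircleProduct.lean`); here the sums run over polymers of a general block side `s`.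

## References
* S. Adams, S. Buchholz, R. Kotecký, S. Müller, *Cauchy–Born rule from microscopic models with
  non-convex potentials*, arXiv:1910.13564, Ch. 6.2 ((6.19), (6.20)), Ch. 6.3 ((6.30)–(6.31))
  [AdamsBuchholzKoteckyMuller2019].
* S. Adams, R. Kotecký, S. Müller, arXiv:1606.09541, Ch. 4 [AdamsKoteckyMuller2016].
-/

noncomputable section

namespace Literature.MathematicalPhysics.StatisticalMechanics.TorusPolymer

open scoped BigOperators Classical
open Finset

variable {d M : ℕ} [NeZero M] {R : Type*} [CommRing R]

/-! ## Polymer subsets and blocks of a set -/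

/-- `𝓟_k(X)`: the `k`-polymers (unions of blocks of side `s = L^k`) contained in `X`.
[cite: AdamsBuchholzKoteckyMuller2019, Ch. 6.2] -/
def polys (s : ℕ) (X : Finset (Fin d → ZMod M)) : Finset (Finset (Fin d → ZMod M)) :=
  X.powerset.filter fun Y => IsPolymer s Y

/-- Membership in `𝓟_k(X)`. [cite: AdamsBuchholzKoteckyMuller2019, Ch. 6.2] -/
theorem mem_polys {s : ℕ} {X Y : Finset (Fin d → ZMod M)} :
    Y ∈ polys s X ↔ Y ⊆ X ∧ IsPolymer s Y := by
  simp [polys]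

/-- `∅ ∈ 𝓟_k(X)`. [cite: AdamsBuchholzKoteckyMuller2019, Ch. 6.2] -/
theorem empty_mem_polys (s : ℕ) (X : Finset (Fin d → ZMod M)) : ∅ ∈ polys s X :=
  mem_polys.2 ⟨empty_subset _, isPolymer_empty s⟩

/-- `X ∈ 𝓟_k(X)` for a polymer `X`. [cite: AdamsBuchholzKoteckyMuller2019, Ch. 6.2] -/
theorem self_mem_polys {s : ℕ} {X : Finset (Fin d → ZMod M)} (hX : IsPolymer s X) : X ∈ polys s X :=
  mem_polys.2 ⟨Subset.rfl, hX⟩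

/-- `𝓟_k(X) ⊆ 𝓟_k(X')` for `X ⊆ X'`. [cite: AdamsBuchholzKoteckyMuller2019, Ch. 6.2] -/
theorem polys_mono (s : ℕ) {X X' : Finset (Fin d → ZMod M)} (h : X ⊆ X') : polys s X ⊆ polys s X' :=
  fun _ hY => mem_polys.2 ⟨(mem_polys.1 hY).1.trans h, (mem_polys.1 hY).2⟩

/-- `𝓑_k(X)`: the blocks of side `s` met by `X` (for a polymer: the blocks it is made of).
[cite: AdamsBuchholzKoteckyMuller2019, Ch. 6.2] -/
def blocks (s : ℕ) (X : Finset (Fin d → ZMod M)) : Finset (Finset (Fin d → ZMod M)) :=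
  X.image (blockOf s)

/-- Membership in `𝓑_k(X)`. [cite: AdamsBuchholzKoteckyMuller2019, Ch. 6.2] -/
theorem mem_blocks {s : ℕ} {X : Finset (Fin d → ZMod M)} {B : Finset (Fin d → ZMod M)} :
    B ∈ blocks s X ↔ ∃ x ∈ X, blockOf s x = B := by
  simp [blocks]

omit [NeZero M] in
/-- `𝓑_k(∅) = ∅`. [cite: AdamsBuchholzKoteckyMuller2019, Ch. 6.2] -/
@[simp] theorem blocks_empty [NeZero M] (s : ℕ) : blocks s (∅ : Finset (Fin d → ZMod M)) = ∅ := by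
  simp [blocks]

/-- `𝓑_k(X ∪ Y) = 𝓑_k(X) ∪ 𝓑_k(Y)`. [cite: AdamsBuchholzKoteckyMuller2019, Ch. 6.2] -/
theorem blocks_union (s : ℕ) (X Y : Finset (Fin d → ZMod M)) :
    blocks s (X ∪ Y) = blocks s X ∪ blocks s Y := by
  simp [blocks, image_union]

/-- `𝓑_k` is monotone. [cite: AdamsBuchholzKoteckyMuller2019, Ch. 6.2] -/
theorem blocks_mono (s : ℕ) {X Y : Finset (Fin d → ZMod M)} (h : X ⊆ Y) : blocks s X ⊆ blocks s Y :=
  image_subset_image h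

/-- Blocks are non-empty. [cite: AdamsBuchholzKoteckyMuller2019, Ch. 6.2] -/
theorem nonempty_of_mem_blocks {s : ℕ} {X B : Finset (Fin d → ZMod M)} (hB : B ∈ blocks s X) :
    B.Nonempty := by
  obtain ⟨x, -, rfl⟩ := mem_blocks.1 hB
  exact ⟨x, mem_blockOf_self s x⟩

/-- A member of `𝓑_k(X)` is a block: `B = B_y` for every `y ∈ B`.
[cite: AdamsBuchholzKoteckyMuller2019, Ch. 6.2] -/
theorem blockOf_eq_of_mem_of_mem_blocks {s : ℕ} {X B : Finset (Fin d → ZMod M)} (hB : B ∈ blocks s X)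
    {y : Fin d → ZMod M} (hy : y ∈ B) : blockOf s y = B := by
  obtain ⟨x, -, rfl⟩ := mem_blocks.1 hB
  exact blockOf_eq_of_mem hy

/-- Two blocks are equal or disjoint. [cite: AdamsBuchholzKoteckyMuller2019, Ch. 6.2] -/
theorem blockOf_disjoint_or_eq (s : ℕ) (x y : Fin d → ZMod M) :
    Disjoint (blockOf s x) (blockOf s y) ∨ blockOf s x = blockOf s y := by
  by_cases h : Disjoint (blockOf s x) (blockOf s y)
  · exact Or.inl h
  · right
    obtain ⟨z, hzx, hzy⟩ := not_disjoint_iff.1 h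
    rw [← blockOf_eq_of_mem hzx, blockOf_eq_of_mem hzy]

/-- The blocks of any set are pairwise disjoint. [cite: AdamsBuchholzKoteckyMuller2019, Ch. 6.2] -/
theorem pairwiseDisjoint_blocks (s : ℕ) (X : Finset (Fin d → ZMod M)) :
    (blocks s X : Set (Finset (Fin d → ZMod M))).PairwiseDisjoint id := by
  intro B hB B' hB' hne
  obtain ⟨x, -, rfl⟩ := mem_blocks.1 hB
  obtain ⟨y, -, rfl⟩ := mem_blocks.1 hB'
  rcases blockOf_disjoint_or_eq s x y with h | h
  · exact h
  · exact absurd h hne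

/-- The blocks of a polymer are contained in it. [cite: AdamsBuchholzKoteckyMuller2019, Ch. 6.2] -/
theorem IsPolymer.subset_of_mem_blocks {s : ℕ} {X B : Finset (Fin d → ZMod M)} (hX : IsPolymer s X)
    (hB : B ∈ blocks s X) : B ⊆ X := by
  obtain ⟨x, hx, rfl⟩ := mem_blocks.1 hB
  exact hX x hx

/-- A polymer is the (disjoint) union of its blocks. [cite: AdamsBuchholzKoteckyMuller2019, Ch. 6.2] -/
theorem IsPolymer.biUnion_blocks {s : ℕ} {X : Finset (Fin d → ZMod M)} (hX : IsPolymer s X) :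
    (blocks s X).biUnion id = X := by
  rw [blocks, Finset.image_biUnion]
  simpa using hX.biUnion_blockOf_eq

/-- A union of blocks is a polymer. [cite: AdamsBuchholzKoteckyMuller2019, Ch. 6.2] -/
theorem isPolymer_biUnion_of_subset_blocks {s : ℕ} {X : Finset (Fin d → ZMod M)}
    {𝓢 : Finset (Finset (Fin d → ZMod M))} (h𝓢 : 𝓢 ⊆ blocks s X) : IsPolymer s (𝓢.biUnion id) := by
  intro y hy
  obtain ⟨B, hB, hyB⟩ := mem_biUnion.1 hy
  rw [blockOf_eq_of_mem_of_mem_blocks (h𝓢 hB) hyB]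
  exact subset_biUnion_of_mem id hB

/-- The blocks of a union `⋃ 𝓢` of blocks are `𝓢`. [cite: AdamsBuchholzKoteckyMuller2019, Ch. 6.2] -/
theorem blocks_biUnion_of_subset_blocks {s : ℕ} {X : Finset (Fin d → ZMod M)}
    {𝓢 : Finset (Finset (Fin d → ZMod M))} (h𝓢 : 𝓢 ⊆ blocks s X) : blocks s (𝓢.biUnion id) = 𝓢 := by
  ext B
  rw [mem_blocks]
  constructor
  · rintro ⟨y, hy, rfl⟩
    obtain ⟨B', hB', hyB'⟩ := mem_biUnion.1 hy
    rwa [blockOf_eq_of_mem_of_mem_blocks (h𝓢 hB') hyB']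
  · intro hB
    obtain ⟨y, hy⟩ := nonempty_of_mem_blocks (h𝓢 hB)
    exact ⟨y, mem_biUnion.2 ⟨B, hB, hy⟩, blockOf_eq_of_mem_of_mem_blocks (h𝓢 hB) hy⟩

/-- Disjoint polymers have disjoint block sets. [cite: AdamsBuchholzKoteckyMuller2019, Ch. 6.2] -/
theorem IsPolymer.disjoint_blocks {s : ℕ} {X Y : Finset (Fin d → ZMod M)} (hX : IsPolymer s X)
    (hY : IsPolymer s Y) (h : Disjoint X Y) : Disjoint (blocks s X) (blocks s Y) := by
  rw [Finset.disjoint_left]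
  intro B hBX hBY
  obtain ⟨y, hy⟩ := nonempty_of_mem_blocks hBX
  exact Finset.disjoint_left.1 h (hX.subset_of_mem_blocks hBX hy) (hY.subset_of_mem_blocks hBY hy)

/-- For polymers `Y ⊆ X`: `𝓑_k(X ∖ Y) = 𝓑_k(X) ∖ 𝓑_k(Y)`. [cite: AdamsBuchholzKoteckyMuller2019, Ch. 6.2] -/
theorem IsPolymer.blocks_sdiff {s : ℕ} {X Y : Finset (Fin d → ZMod M)} (hX : IsPolymer s X)
    (hY : IsPolymer s Y) (hYX : Y ⊆ X) : blocks s (X \ Y) = blocks s X \ blocks s Y := by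
  have hd : Disjoint (blocks s (X \ Y)) (blocks s Y) :=
    (hX.sdiff hY).disjoint_blocks hY sdiff_disjoint
  have hu : blocks s (X \ Y) ∪ blocks s Y = blocks s X := by
    rw [← blocks_union, sdiff_union_of_subset hYX]
  rw [← hu, union_sdiff_right, hd.sdiff_eq_left]

/-- **`𝓟_k(X) ≃ 2^{𝓑_k(X)}`**: a sum over the polymers inside a polymer `X` is a sum over the sets
of blocks of `X` (`Y ↦ 𝓑_k(Y)`, inverse `𝓢 ↦ ⋃𝓢`). [cite: AdamsBuchholzKoteckyMuller2019, Ch. 6.2] -/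
theorem sum_polys_eq_sum_powerset_blocks {s : ℕ} {X : Finset (Fin d → ZMod M)} (hX : IsPolymer s X)
    {A : Type*} [AddCommMonoid A] (f : Finset (Fin d → ZMod M) → A) :
    ∑ Y ∈ polys s X, f Y = ∑ 𝓢 ∈ (blocks s X).powerset, f (𝓢.biUnion id) := by
  refine Finset.sum_nbij' (fun Y => blocks s Y) (fun 𝓢 => 𝓢.biUnion id) ?_ ?_ ?_ ?_ ?_
  · intro Y hY
    exact mem_powerset.2 (blocks_mono s (mem_polys.1 hY).1)
  · intro 𝓢 h𝓢
    rw [mem_powerset] at h𝓢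
    refine mem_polys.2 ⟨?_, isPolymer_biUnion_of_subset_blocks h𝓢⟩
    intro y hy
    obtain ⟨B, hB, hyB⟩ := mem_biUnion.1 hy
    exact hX.subset_of_mem_blocks (h𝓢 hB) hyB
  · intro Y hY
    exact (mem_polys.1 hY).2.biUnion_blocks
  · intro 𝓢 h𝓢
    exact blocks_biUnion_of_subset_blocks (mem_powerset.1 h𝓢)
  · intro Y hY
    simp only [(mem_polys.1 hY).2.biUnion_blocks]

/-! ## Block products `F^X` -/

/-- `F^X = ∏_{B ∈ 𝓑_k(X)} F(B)`: the multiplicative extension of a one-block functional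
(`F ∈ M(𝓑_k)` viewed in `M(𝓟_k)`, [ABKM19] before (6.19)); at a fixed field configuration the
values are scalars, so `F : Finset Λ → R`. [cite: AdamsBuchholzKoteckyMuller2019, Ch. 6.2] -/
def bprod (s : ℕ) (F : Finset (Fin d → ZMod M) → R) (X : Finset (Fin d → ZMod M)) : R :=
  ∏ B ∈ blocks s X, F B

omit [NeZero M] in
/-- `F^∅ = 1`. [cite: AdamsBuchholzKoteckyMuller2019, Ch. 6.2] -/
@[simp] theorem bprod_empty [NeZero M] (s : ℕ) (F : Finset (Fin d → ZMod M) → R) : bprod s F ∅ = 1 := by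
  simp [bprod]

/-- `F^{B} = F(B)` on a single block. [cite: AdamsBuchholzKoteckyMuller2019, Ch. 6.2] -/
theorem bprod_blockOf (s : ℕ) (F : Finset (Fin d → ZMod M) → R) (x : Fin d → ZMod M) :
    bprod s F (blockOf s x) = F (blockOf s x) := by
  have h : blocks s (blockOf s x) = {blockOf s x} := by
    ext B
    rw [mem_blocks, mem_singleton]
    constructor
    · rintro ⟨y, hy, rfl⟩; exact blockOf_eq_of_mem hy
    · rintro rfl; exact ⟨x, mem_blockOf_self s x, rfl⟩
  simp [bprod, h]

/-- **Multiplicativity over disjoint polymers**: `F^{X ∪ Y} = F^X F^Y`.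
[cite: AdamsBuchholzKoteckyMuller2019, Ch. 6.2] -/
theorem bprod_union {s : ℕ} (F : Finset (Fin d → ZMod M) → R) {X Y : Finset (Fin d → ZMod M)}
    (hX : IsPolymer s X) (hY : IsPolymer s Y) (h : Disjoint X Y) :
    bprod s F (X ∪ Y) = bprod s F X * bprod s F Y := by
  rw [bprod, blocks_union, prod_union (hX.disjoint_blocks hY h), bprod, bprod]

/-- `(FG)^X = F^X G^X`. [cite: AdamsBuchholzKoteckyMuller2019, Ch. 6.2] -/
theorem bprod_mul (s : ℕ) (F G : Finset (Fin d → ZMod M) → R) (X : Finset (Fin d → ZMod M)) :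
    bprod s (fun B => F B * G B) X = bprod s F X * bprod s G X := by
  simp [bprod, prod_mul_distrib]

/-- `F^X G^X = 1` when `F(B) G(B) = 1` blockwise (inverse block functionals, `Ĩ^{−X} = (Ĩ^X)⁻¹`).
[cite: AdamsBuchholzKoteckyMuller2019, Ch. 6.3 (6.32)] -/
theorem bprod_mul_bprod_eq_one {s : ℕ} {F G : Finset (Fin d → ZMod M) → R} {X : Finset (Fin d → ZMod M)}
    (h : ∀ B ∈ blocks s X, F B * G B = 1) : bprod s F X * bprod s G X = 1 := by
  rw [← bprod_mul, bprod]
  exact prod_eq_one h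

/-- `1^X = 1`. [cite: AdamsBuchholzKoteckyMuller2019, Ch. 6.2] -/
@[simp] theorem bprod_one (s : ℕ) (X : Finset (Fin d → ZMod M)) :
    bprod s (fun _ => (1 : R)) X = 1 := by
  simp [bprod]

/-- Congruence: `F^X` depends only on `F` on the blocks of `X`. [cite: AdamsBuchholzKoteckyMuller2019, Ch. 6.2] -/
theorem bprod_congr {s : ℕ} {F G : Finset (Fin d → ZMod M) → R} {X : Finset (Fin d → ZMod M)}
    (h : ∀ B ∈ blocks s X, F B = G B) : bprod s F X = bprod s G X :=
  prod_congr rfl h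

/-! ## The circle product at scale `k` -/

/-- **The circle product** `(F ∘ G)(X) = Σ_{Y ∈ 𝓟_k(X)} F(Y) G(X ∖ Y)` ([ABKM19] (6.19)).
[cite: AdamsBuchholzKoteckyMuller2019, Ch. 6.2 (6.19)] -/
def pcirc (s : ℕ) (F G : Finset (Fin d → ZMod M) → R) (X : Finset (Fin d → ZMod M)) : R :=
  ∑ Y ∈ polys s X, F Y * G (X \ Y)

/-- The unit `𝟙_∅` of the circle product. [cite: AdamsBuchholzKoteckyMuller2019, Ch. 6.2] -/
def punit (X : Finset (Fin d → ZMod M)) : R := if X = ∅ then 1 else 0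

omit [NeZero M] in
/-- `𝟙_∅(∅) = 1`. [cite: AdamsBuchholzKoteckyMuller2019, Ch. 6.2] -/
@[simp] theorem punit_empty : (punit (∅ : Finset (Fin d → ZMod M)) : R) = 1 := by simp [punit]

/-- `(F ∘ G)(∅) = F(∅) G(∅)`. [cite: AdamsBuchholzKoteckyMuller2019, Ch. 6.2] -/
@[simp] theorem pcirc_empty (s : ℕ) (F G : Finset (Fin d → ZMod M) → R) :
    pcirc s F G ∅ = F ∅ * G ∅ := by
  have : polys s (∅ : Finset (Fin d → ZMod M)) = {∅} := by
    ext Y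
    rw [mem_polys, mem_singleton, subset_empty]
    exact ⟨fun h => h.1, fun h => ⟨h, h ▸ isPolymer_empty s⟩⟩
  simp [pcirc, this]

/-- `(F ∘ G)(X) = Σ_{Y ∈ 𝓟_k(X)} F(X ∖ Y) G(Y)` on a polymer (reflect `Y ↦ X ∖ Y`).
[cite: AdamsBuchholzKoteckyMuller2019, Ch. 6.2] -/
theorem pcirc_apply_symm {s : ℕ} (F G : Finset (Fin d → ZMod M) → R) {X : Finset (Fin d → ZMod M)}
    (hX : IsPolymer s X) : pcirc s F G X = ∑ Y ∈ polys s X, F (X \ Y) * G Y := by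
  unfold pcirc
  refine Finset.sum_nbij' (fun Y => X \ Y) (fun Y => X \ Y) ?_ ?_ ?_ ?_ ?_
  · intro Y hY; exact mem_polys.2 ⟨sdiff_subset, hX.sdiff (mem_polys.1 hY).2⟩
  · intro Y hY; exact mem_polys.2 ⟨sdiff_subset, hX.sdiff (mem_polys.1 hY).2⟩
  · intro Y hY; exact Finset.sdiff_sdiff_eq_self (mem_polys.1 hY).1
  · intro Y hY; exact Finset.sdiff_sdiff_eq_self (mem_polys.1 hY).1
  · intro Y hY; rw [Finset.sdiff_sdiff_eq_self (mem_polys.1 hY).1]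

/-- **Commutativity** on polymers. [cite: AdamsBuchholzKoteckyMuller2019, Ch. 6.2] -/
theorem pcirc_comm {s : ℕ} (F G : Finset (Fin d → ZMod M) → R) {X : Finset (Fin d → ZMod M)}
    (hX : IsPolymer s X) : pcirc s F G X = pcirc s G F X := by
  rw [pcirc_apply_symm F G hX]
  exact Finset.sum_congr rfl fun Y _ => mul_comm _ _

/-- `𝟙_∅` is a left unit (on every set). [cite: AdamsBuchholzKoteckyMuller2019, Ch. 6.2] -/
theorem punit_pcirc (s : ℕ) (F : Finset (Fin d → ZMod M) → R) (X : Finset (Fin d → ZMod M)) :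
    pcirc s punit F X = F X := by
  unfold pcirc punit
  rw [Finset.sum_eq_single ∅]
  · simp
  · intro Y _ hY; simp [hY]
  · intro h; exact absurd (empty_mem_polys s X) h

/-- `𝟙_∅` is a right unit on polymers. [cite: AdamsBuchholzKoteckyMuller2019, Ch. 6.2] -/
theorem pcirc_punit {s : ℕ} (F : Finset (Fin d → ZMod M) → R) {X : Finset (Fin d → ZMod M)}
    (hX : IsPolymer s X) : pcirc s F punit X = F X := by
  rw [pcirc_comm F punit hX, punit_pcirc]

/-- Congruence in the first argument: only the values of `F` on `𝓟_k(X)` matter.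
[cite: AdamsBuchholzKoteckyMuller2019, Ch. 6.2] -/
theorem pcirc_congr_left {s : ℕ} {F F' : Finset (Fin d → ZMod M) → R} (G : Finset (Fin d → ZMod M) → R)
    {X : Finset (Fin d → ZMod M)} (h : ∀ Y, IsPolymer s Y → Y ⊆ X → F Y = F' Y) :
    pcirc s F G X = pcirc s F' G X :=
  Finset.sum_congr rfl fun Y hY => by rw [h Y (mem_polys.1 hY).2 (mem_polys.1 hY).1]

/-- Congruence in the second argument on a polymer: only the values of `G` on `𝓟_k(X)` matter.
[cite: AdamsBuchholzKoteckyMuller2019, Ch. 6.2] -/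
theorem pcirc_congr_right {s : ℕ} (F : Finset (Fin d → ZMod M) → R) {G G' : Finset (Fin d → ZMod M) → R}
    {X : Finset (Fin d → ZMod M)} (hX : IsPolymer s X)
    (h : ∀ Y, IsPolymer s Y → Y ⊆ X → G Y = G' Y) : pcirc s F G X = pcirc s F G' X :=
  Finset.sum_congr rfl fun Y hY => by rw [h (X \ Y) (hX.sdiff (mem_polys.1 hY).2) sdiff_subset]

/-- **Associativity** (on every set): both sides are the sum over ordered decompositions
`X = Y₁ ⊔ Y₂ ⊔ Y₃`, `Y₁, Y₂` polymers, of `F(Y₁) G(Y₂) H(Y₃)`. [cite: AdamsBuchholzKoteckyMuller2019, Ch. 6.2] -/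
theorem pcirc_assoc {s : ℕ} (F G H : Finset (Fin d → ZMod M) → R) (X : Finset (Fin d → ZMod M)) :
    pcirc s (pcirc s F G) H X = pcirc s F (pcirc s G H) X := by
  have lhs : pcirc s (pcirc s F G) H X
      = ∑ p ∈ (polys s X).sigma (fun Y => polys s Y), F p.2 * G (p.1 \ p.2) * H (X \ p.1) := by
    unfold pcirc
    rw [Finset.sum_sigma]
    exact Finset.sum_congr rfl fun Y _ => by rw [Finset.sum_mul]
  have rhs : pcirc s F (pcirc s G H) X
      = ∑ p ∈ (polys s X).sigma (fun Z => polys s (X \ Z)), F p.1 * G p.2 * H ((X \ p.1) \ p.2) := by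
    unfold pcirc
    rw [Finset.sum_sigma]
    refine Finset.sum_congr rfl fun Z _ => ?_
    rw [Finset.mul_sum]
    exact Finset.sum_congr rfl fun W _ => by ring
  rw [lhs, rhs]
  refine Finset.sum_nbij' (fun p => ⟨p.2, p.1 \ p.2⟩) (fun q => ⟨q.1 ∪ q.2, q.1⟩) ?_ ?_ ?_ ?_ ?_
  · rintro ⟨Y, Z⟩ h
    simp only [mem_sigma, mem_polys] at h ⊢
    exact ⟨⟨h.2.1.trans h.1.1, h.2.2⟩, sdiff_subset_sdiff h.1.1 le_rfl, h.1.2.sdiff h.2.2⟩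
  · rintro ⟨Z, W⟩ h
    simp only [mem_sigma, mem_polys] at h ⊢
    exact ⟨⟨union_subset h.1.1 (h.2.1.trans sdiff_subset), h.1.2.union h.2.2⟩, subset_union_left,
      h.1.2⟩
  · rintro ⟨Y, Z⟩ h
    simp only [mem_sigma, mem_polys] at h
    simp only [union_sdiff_of_subset h.2.1]
  · rintro ⟨Z, W⟩ h
    simp only [mem_sigma, mem_polys] at h ⊢
    have hdis : Disjoint Z W := disjoint_of_subset_right h.2.1 disjoint_sdiff
    simp only [union_sdiff_left, hdis.symm.sdiff_eq_left]
  · rintro ⟨Y, Z⟩ h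
    simp only [mem_sigma, mem_polys] at h
    have hYZ : Z ⊔ Y \ Z = Y := by
      rw [Finset.sup_eq_union, Finset.union_sdiff_of_subset h.2.1]
    simp only [sdiff_sdiff_left, hYZ]

/-! ## The binomial expansion over blocks ([ABKM19] (6.20)) -/

/-- **`(F₁ + F₂)^X = (F₁^∘ ∘ F₂^∘)(X)`** for a polymer `X` ([ABKM19] (6.20); Brydges' binomial
expansion over blocks). [cite: AdamsBuchholzKoteckyMuller2019, Ch. 6.2 (6.20)] -/
theorem pcirc_bprod_bprod {s : ℕ} (F₁ F₂ : Finset (Fin d → ZMod M) → R) {X : Finset (Fin d → ZMod M)}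
    (hX : IsPolymer s X) :
    pcirc s (bprod s F₁) (bprod s F₂) X = bprod s (fun B => F₁ B + F₂ B) X := by
  unfold pcirc
  rw [bprod, Finset.prod_add, sum_polys_eq_sum_powerset_blocks hX]
  refine Finset.sum_congr rfl fun 𝓢 h𝓢 => ?_
  rw [mem_powerset] at h𝓢
  have hY : IsPolymer s (𝓢.biUnion id) := isPolymer_biUnion_of_subset_blocks h𝓢
  have hYX : 𝓢.biUnion id ⊆ X := fun y hy => by
    obtain ⟨B, hB, hyB⟩ := mem_biUnion.1 hy
    exact hX.subset_of_mem_blocks (h𝓢 hB) hyB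
  rw [bprod, bprod, blocks_biUnion_of_subset_blocks h𝓢, hX.blocks_sdiff hY hYX,
    blocks_biUnion_of_subset_blocks h𝓢]

/-- **`F^X = (G^∘ ∘ (F − G)^∘)(X)`** — e.g. `I = Ĩ ∘ (I − Ĩ)` and `I − Ĩ = (1 − Ĩ) ∘ (I − 1)` at the
start of the reblocking (6.31). [cite: AdamsBuchholzKoteckyMuller2019, Ch. 6.3 (6.31)] -/
theorem bprod_eq_pcirc_sub {s : ℕ} (F G : Finset (Fin d → ZMod M) → R) {X : Finset (Fin d → ZMod M)}
    (hX : IsPolymer s X) :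
    bprod s F X = pcirc s (bprod s G) (bprod s fun B => F B - G B) X := by
  rw [pcirc_bprod_bprod G (fun B => F B - G B) hX]
  exact bprod_congr fun B _ => by ring

/-- **`I^X = (Ĩ^∘ ∘ ((1 − Ĩ)^∘ ∘ (I − 1)^∘))(X)`** — the three-factor expansion behind (6.31):
`I = Ĩ + (1 − Ĩ) + (I − 1)`. [cite: AdamsBuchholzKoteckyMuller2019, Ch. 6.3 (6.31)] -/
theorem bprod_eq_pcirc_three {s : ℕ} (I It : Finset (Fin d → ZMod M) → R) {X : Finset (Fin d → ZMod M)}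
    (hX : IsPolymer s X) :
    bprod s I X = pcirc s (bprod s It)
      (pcirc s (bprod s fun B => 1 - It B) (bprod s fun B => I B - 1)) X := by
  rw [bprod_eq_pcirc_sub I It hX]
  refine pcirc_congr_right _ hX fun Y hY _ => ?_
  rw [pcirc_bprod_bprod _ _ hY]
  exact bprod_congr fun B _ => by ring

/-! ## Two scales: `(k+1)`-blocks are unions of `k`-blocks -/

omit [NeZero M] in
/-- **Nesting of the block index**: for odd `s, L` the index of the `(Ls)`-block is
`⌊(b + (L−1)/2)/L⌋` for the index `b` of the `s`-block (the centred cube of side `Ls` is the union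
of the `L^d` centred cubes of side `s` around it). [cite: AdamsKoteckyMuller2016, Ch. 4] -/
theorem resIndex_mul {s L : ℕ} (hs : Odd s) (hL : Odd L) (v : ZMod M) :
    resIndex (L * s) v = (resIndex s v + ((L : ℤ) - 1) / 2) / (L : ℤ) := by
  obtain ⟨h, rfl⟩ := hs
  obtain ⟨l, rfl⟩ := hL
  unfold resIndex
  have e1 : (((2 * h + 1 : ℕ) : ℤ) - 1) / 2 = h := by push_cast; omega
  have e2 : (((2 * l + 1 : ℕ) : ℤ) - 1) / 2 = l := by push_cast; omega
  have e3 : ((((2 * l + 1) * (2 * h + 1) : ℕ) : ℤ) - 1) / 2 = h + (2 * h + 1) * l := by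
    push_cast
    have : ((2 * (l : ℤ) + 1) * (2 * h + 1) - 1) = 2 * (h + (2 * h + 1) * l) := by ring
    rw [this]; omega
  rw [e1, e2, e3]
  have hs0 : (0 : ℤ) < 2 * h + 1 := by positivity
  push_cast
  rw [show v.valMinAbs + ((h : ℤ) + (2 * h + 1) * l) = (v.valMinAbs + h) + (2 * h + 1) * l by ring,
    show (2 * (l : ℤ) + 1) * (2 * h + 1) = (2 * h + 1) * (2 * l + 1) by ring,
    ← Int.ediv_ediv_of_nonneg hs0.le, Int.add_mul_ediv_left _ _ hs0.ne']

/-- **Every `(Ls)`-block is a union of `s`-blocks** (`s, L` odd): `B_x^{(s)} ⊆ B_x^{(Ls)}`.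
[cite: AdamsKoteckyMuller2016, Ch. 4] -/
theorem blockOf_subset_blockOf_mul {s L : ℕ} (hs : Odd s) (hL : Odd L) (x : Fin d → ZMod M) :
    blockOf s x ⊆ blockOf (L * s) x := by
  intro y hy
  rw [mem_blockOf] at hy ⊢
  intro i
  rw [cubeIndex_eq_resIndex, cubeIndex_eq_resIndex, resIndex_mul hs hL, resIndex_mul hs hL,
    ← cubeIndex_eq_resIndex, ← cubeIndex_eq_resIndex, hy i]

/-- **`(k+1)`-polymers are `k`-polymers** (`s, L` odd). [cite: AdamsKoteckyMuller2016, Ch. 4] -/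
theorem IsPolymer.of_mul {s L : ℕ} (hs : Odd s) (hL : Odd L) {X : Finset (Fin d → ZMod M)}
    (hX : IsPolymer (L * s) X) : IsPolymer s X :=
  fun x hx => (blockOf_subset_blockOf_mul hs hL x).trans (hX x hx)

/-- The `s`-blocks of an `(Ls)`-polymer are the `s`-blocks of its `(Ls)`-blocks.
[cite: AdamsKoteckyMuller2016, Ch. 4] -/
theorem blocks_eq_biUnion_blocks_mul {s L : ℕ} {X : Finset (Fin d → ZMod M)}
    (hX : IsPolymer (L * s) X) : blocks s X = (blocks (L * s) X).biUnion (blocks s) := by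
  conv_lhs => rw [← hX.biUnion_blocks]
  rw [blocks, Finset.biUnion_image]
  rfl

/-- **`F^U` at scale `k` is `(B' ↦ F^{B'})^U` at scale `k+1`** for a `(k+1)`-polymer `U`:
`∏_{B ∈ 𝓑_k(U)} F(B) = ∏_{B' ∈ 𝓑_{k+1}(U)} ∏_{B ∈ 𝓑_k(B')} F(B)` — how `e^{−H_{k+1}}` with
`H_{k+1}(B') = Σ_{B ∈ 𝓑_k(B')} H̃_k(B)` arises in Definition 6.5.
[cite: AdamsBuchholzKoteckyMuller2019, Ch. 6.3 (6.39)] -/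
theorem bprod_eq_bprod_mul {s L : ℕ} (hs : Odd s) (hL : Odd L) (F : Finset (Fin d → ZMod M) → R)
    {U : Finset (Fin d → ZMod M)} (hU : IsPolymer (L * s) U) :
    bprod s F U = bprod (L * s) (fun B' => bprod s F B') U := by
  rw [bprod, blocks_eq_biUnion_blocks_mul hU, prod_biUnion]
  · rfl
  · intro B₁ hB₁ B₂ hB₂ hne
    have hd : Disjoint B₁ B₂ := pairwiseDisjoint_blocks (L * s) U hB₁ hB₂ hne
    have hp₁ : IsPolymer s B₁ := by
      obtain ⟨x, -, rfl⟩ := mem_blocks.1 hB₁; exact (isPolymer_blockOf _ x).of_mul hs hL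
    have hp₂ : IsPolymer s B₂ := by
      obtain ⟨x, -, rfl⟩ := mem_blocks.1 hB₂; exact (isPolymer_blockOf _ x).of_mul hs hL
    simpa using hp₁.disjoint_blocks hp₂ hd

/-! ## The last scale: one block -/

/-- **On an odd torus the block of side `M` is the whole torus** (`𝓑_N = {Λ_N}`).
[cite: AdamsKoteckyMuller2016, Ch. 4] -/
theorem blockOf_eq_univ (hM : Odd M) (x : Fin d → ZMod M) : blockOf M x = univ := by
  ext y
  simp only [mem_univ, iff_true, mem_blockOf]
  have h0 : ∀ v : ZMod M, resIndex M v = 0 := by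
    intro v
    rw [resIndex_eq_iff hM]
    have h1 := natAbs_valMinAbs_le_half hM v
    have hM1 : (((M : ℤ)) - 1) / 2 = (((M - 1) / 2 : ℕ) : ℤ) := by
      obtain ⟨m, rfl⟩ := hM; push_cast; omega
    rw [mul_zero, zero_sub, zero_add, hM1]
    constructor <;> omega
  intro i
  rw [cubeIndex_eq_resIndex, cubeIndex_eq_resIndex, h0, h0]

/-- At the last scale the only polymers are `∅` and `Λ`. [cite: AdamsKoteckyMuller2016, Ch. 4] -/
theorem IsPolymer.eq_empty_or_eq_univ (hM : Odd M) {X : Finset (Fin d → ZMod M)} (hX : IsPolymer M X) :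
    X = ∅ ∨ X = univ := by
  rcases X.eq_empty_or_nonempty with h | ⟨x, hx⟩
  · exact Or.inl h
  · right
    exact eq_univ_of_forall fun y => hX x hx (by rw [blockOf_eq_univ hM]; exact mem_univ y)

/-- **`(F ∘ G)(Λ) = F(∅) G(Λ) + F(Λ) G(∅)` at the last scale** (odd torus with at least two
points): `(e^{−H_N} ∘ K_N)(Λ_N) = e^{−H_N(Λ_N)} + K_N(Λ_N)` when `e^{−H}(∅) = K(∅) = 1`.
[cite: AdamsBuchholzKoteckyMuller2019, Ch. 4.3 (after (4.19))] -/
theorem pcirc_univ_last (hM : Odd M) (hne : (univ : Finset (Fin d → ZMod M)) ≠ ∅)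
    (F G : Finset (Fin d → ZMod M) → R) :
    pcirc M F G univ = F ∅ * G univ + F univ * G ∅ := by
  unfold pcirc
  have hp : polys M (univ : Finset (Fin d → ZMod M)) = {∅, univ} := by
    ext Y
    rw [mem_polys, mem_insert, mem_singleton]
    constructor
    · rintro ⟨-, hY⟩; exact hY.eq_empty_or_eq_univ hM
    · rintro (rfl | rfl)
      · exact ⟨empty_subset _, isPolymer_empty M⟩
      · exact ⟨Subset.rfl, isPolymer_univ M⟩
  rw [hp, sum_pair (Ne.symm hne)]
  simp

end Literature.MathematicalPhysics.StatisticalMechanics.TorusPolymer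

end
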